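import Summits.ValiantsHypothesis.ValiantsHypothesis.Theorems.LacunarySymmetroidMatrixDescartesCensusDoorA34IsotropicTangent
import Summits.ValiantsHypothesis.ValiantsHypothesis.Theorems.LacunarySymmetroidMatrixDescartesCensusSpanRankDiagonal

/-!
# `MatrixDescartes` census — DOOR A at `(3,4)`: the DIAGONAL-TRIPLE HAMMING LAW — a Descartes deficiency `Z₊ ≤ 18` for `(3,4)` pencils
# three of whose letters are simultaneously diagonalisable (all supports failing a Hamming test)

HONEST FRAMING.  Object-search cell `pub-symmetroid`, door-A seat `val-sym-door-p3` (g14); helper file beside the OPEN typed statement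
`DoorA34 = PosRootLawAt 3 4 18` (route item `Theses.LacunarySymmetroid.DoorA34`, stmt-ValiantsHypothesis-19980), asserted nowhere.  Companion
of `…CensusDoorA34IsotropicTangent` (the tangent-pencil parity law): the same EDGE-EXACTNESS mechanism on a second full-support family.

THE FAMILY.  Three of the four letters, `S_i, S_j, S_k` (`{i,j,k} = {0,1,2,3} ∖ {m}`), are DIAGONAL — equivalently (congruence invariance,
`…SpanRankDiagonal.posRootCount_congr`) simultaneously diagonalisable by ONE real congruence — and `S_m` is an arbitrary real `3 × 3` matrix:
all `20` triple-sum monomials present (generically), any inertias (the word `IIII` included); with four diagonal letters the count is `≤ 9`.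

THE LAW (kernel-checked, every support):
* `det_diagLetter`, `trace_adjugate_diagLetters` — the FACE block (coefficients at the `10` triple sums avoiding `d_m`) of such a pencil is the
  product of the three «row» `3`-nomials `∑_{l ≠ m} (S_l)_{nn} X^(d l)`; on an EDGE `{a,b}` of the face the four coefficients at
  `3d_a, 2d_a+d_b, d_a+2d_b, 3d_b` are those of the REAL-ROOTED binary cubic `∏ₙ ((S_a)ₙₙ + s (S_b)ₙₙ)`;
* `tripleLin_*` — DESCARTES IS EXACT on a real-rooted cubic: the number of sign changes along its four coefficients EQUALS the number of
  rows `n` with `(S_a)ₙₙ (S_b)ₙₙ < 0` (the HAMMING DISTANCE of the sign columns `a`, `b` of the `3 × 3` matrix of diagonal entries) — proved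
  here as sign lemmas (`tripleLin_all_pos/neg`, the MAJORITY lemma `tripleLin_majority_pos/neg`, and the count `tripleLin_count`);
* `diag_edge_count` — for a NINETEEN (full alternation, `…FullAlternation`) that number is read off the ranks of the four edge exponents in the
  triple-sum table of `d`: `V_ab = #odd among ρ(3d_a)+ρ(2d_a+d_b), ρ(2d_a+d_b)+ρ(2d_b+d_a), ρ(2d_b+d_a)+ρ(3d_b)`;
* `hamming_row` — three Hamming distances of sign vectors of length `3` have even sum `≤ 6` and satisfy the triangle inequality; so
* **`card_posRoots_diagTriple_le_18`** — if the triple `(V_ij, V_ik, V_jk)` computed from `d` has `V_ij + V_ik + V_jk = 8` or violates a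
  triangle inequality, NO such pencil has `19` roots: **`Z₊ ≤ 18`**; `card_posRoots_diagTriple_congr_le_18` transports it to three letters
  `Pᵀ D_l P` with a common invertible `P`; instances by `decide`: `…_on_0_1_7_11` (`m = 0`, `V = (3,2,3)`), `…_on_0_4_9_16_top` (`m = 3`, `V = (2,3,3)`),
  `…_on_0_2_9_12` (`m = 0`, `V = (1,0,3)`).

SCOPE (located bookkeeping, seat script `parity.py`, not a theorem): the test holds for `496/448/448/496` of the `2060` sorted 3-Sidon supports
`d₃ ≤ 30` at `m = 0/1/2/3` (`926` for some `m`, `170` for all); where it fails the family DOES realise full alternation (located: `(0,1,4,13)`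
`m = 0`, `(0,4,9,16)` `m = 0`, `(0,1,7,11)` `m = 2` reach `19` sign changes in seconds), so the law is exactly the sign-level content of the
mechanism.  Nothing here bounds `ζ_sym(3,4)` (`∈ {18,19}` unchanged) or `DoorA34`; nothing bears on `MatrixDescartes` (stmt-ValiantsHypothesis-18050)
or on `VP ≠ VNP` — VP≠VNP not moved.

[folklore] Descartes' rule of signs is exact for real-rooted polynomials; elementary.
-/

-- `Summit.ValiantsHypothesis.ValiantsHypothesis.…` repeats a component by the D-0017 layout
-- (single-conjunct summit), which the `dupNamespace` linter flags; the name is mandated.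
set_option linter.dupNamespace false

namespace Summit.ValiantsHypothesis.ValiantsHypothesis.Theorems.LacunarySymmetroidMatrixDescartes.Census

open Polynomial Finset
open scoped BigOperators Polynomial Matrix
open Summit.ValiantsHypothesis.ValiantsHypothesis.Theorems.LacunarySymmetroidMatrixDescartes.Census.SignSplit (pencil posRootCount)

/-! ## 1. Descartes is exact for a product of three real linear forms -/

/-- The adjacent coefficient products of `∏ₙ (aₙ + bₙ s) = c₀ + c₁ s + c₂ s² + c₃ s³` in terms of `pₙ = aₙbₙ`:
`c₀c₁ = Σ pₙ ∏_{n'≠n} a_{n'}²`, `c₂c₃ = Σ pₙ ∏_{n'≠n} b_{n'}²`, `c₁c₂ = 3p₀p₁p₂ + Σ_k p_k (a_n²b_{n'}² + a_{n'}²b_n²)`, `c₀c₃ = p₀p₁p₂`. [folklore] -/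
theorem tripleLin_products (a₀ a₁ a₂ b₀ b₁ b₂ : ℝ) :
    (a₀ * a₁ * a₂) * (b₀ * a₁ * a₂ + a₀ * b₁ * a₂ + a₀ * a₁ * b₂)
        = (a₀ * b₀) * (a₁ ^ 2 * a₂ ^ 2) + (a₁ * b₁) * (a₀ ^ 2 * a₂ ^ 2) + (a₂ * b₂) * (a₀ ^ 2 * a₁ ^ 2) ∧
      (a₀ * b₁ * b₂ + b₀ * a₁ * b₂ + b₀ * b₁ * a₂) * (b₀ * b₁ * b₂)
        = (a₀ * b₀) * (b₁ ^ 2 * b₂ ^ 2) + (a₁ * b₁) * (b₀ ^ 2 * b₂ ^ 2) + (a₂ * b₂) * (b₀ ^ 2 * b₁ ^ 2) ∧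
      (b₀ * a₁ * a₂ + a₀ * b₁ * a₂ + a₀ * a₁ * b₂) * (a₀ * b₁ * b₂ + b₀ * a₁ * b₂ + b₀ * b₁ * a₂)
        = 3 * ((a₀ * b₀) * (a₁ * b₁) * (a₂ * b₂)) + (a₀ * b₀) * (a₁ ^ 2 * b₂ ^ 2 + a₂ ^ 2 * b₁ ^ 2)
          + (a₁ * b₁) * (a₀ ^ 2 * b₂ ^ 2 + a₂ ^ 2 * b₀ ^ 2) + (a₂ * b₂) * (a₀ ^ 2 * b₁ ^ 2 + a₁ ^ 2 * b₀ ^ 2) ∧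
      (a₀ * a₁ * a₂) * (b₀ * b₁ * b₂) = (a₀ * b₀) * (a₁ * b₁) * (a₂ * b₂) := by
  refine ⟨by ring, by ring, by ring, by ring⟩

/-- All three rows positive (`aₙbₙ > 0`): no sign change (`c₀c₁, c₁c₂, c₂c₃ > 0`). [folklore] -/
theorem tripleLin_all_pos {a₀ a₁ a₂ b₀ b₁ b₂ : ℝ} (h0 : 0 < a₀ * b₀) (h1 : 0 < a₁ * b₁) (h2 : 0 < a₂ * b₂) :
    0 < (a₀ * a₁ * a₂) * (b₀ * a₁ * a₂ + a₀ * b₁ * a₂ + a₀ * a₁ * b₂) ∧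
    0 < (b₀ * a₁ * a₂ + a₀ * b₁ * a₂ + a₀ * a₁ * b₂) * (a₀ * b₁ * b₂ + b₀ * a₁ * b₂ + b₀ * b₁ * a₂) ∧
    0 < (a₀ * b₁ * b₂ + b₀ * a₁ * b₂ + b₀ * b₁ * a₂) * (b₀ * b₁ * b₂) := by
  obtain ⟨e1, e3, e2, -⟩ := tripleLin_products a₀ a₁ a₂ b₀ b₁ b₂
  obtain ⟨ha0, hb0⟩ := mul_ne_zero_iff.mp h0.ne'; obtain ⟨ha1, hb1⟩ := mul_ne_zero_iff.mp h1.ne'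
  obtain ⟨ha2, hb2⟩ := mul_ne_zero_iff.mp h2.ne'
  exact ⟨by rw [e1]; positivity, by rw [e2]; positivity, by rw [e3]; positivity⟩

/-- All three rows negative: three sign changes (`c₀c₁, c₁c₂, c₂c₃ < 0`). [folklore] -/
theorem tripleLin_all_neg {a₀ a₁ a₂ b₀ b₁ b₂ : ℝ} (h0 : a₀ * b₀ < 0) (h1 : a₁ * b₁ < 0) (h2 : a₂ * b₂ < 0) :
    (a₀ * a₁ * a₂) * (b₀ * a₁ * a₂ + a₀ * b₁ * a₂ + a₀ * a₁ * b₂) < 0 ∧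
    (b₀ * a₁ * a₂ + a₀ * b₁ * a₂ + a₀ * a₁ * b₂) * (a₀ * b₁ * b₂ + b₀ * a₁ * b₂ + b₀ * b₁ * a₂) < 0 ∧
    (a₀ * b₁ * b₂ + b₀ * a₁ * b₂ + b₀ * b₁ * a₂) * (b₀ * b₁ * b₂) < 0 := by
  obtain ⟨p1, p2, p3⟩ := tripleLin_all_pos (a₀ := a₀) (a₁ := a₁) (a₂ := a₂) (b₀ := -b₀) (b₁ := -b₁) (b₂ := -b₂)
    (by linarith) (by linarith) (by linarith)
  refine ⟨by linarith, by linarith, by linarith⟩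

/-- **Majority lemma, positive.**  If rows `0` and `1` are positive (`a₀b₀, a₁b₁ > 0`) then `c₀c₁ > 0` or `c₂c₃ > 0` — at most two of the
three adjacent pairs can alternate (all `aₙ, bₙ ≠ 0`). [folklore] -/
theorem tripleLin_majority_pos {a₀ a₁ a₂ b₀ b₁ b₂ : ℝ} (h0 : 0 < a₀ * b₀) (h1 : 0 < a₁ * b₁) (ha2 : a₂ ≠ 0) (hb2 : b₂ ≠ 0) :
    0 < (a₀ * a₁ * a₂) * (b₀ * a₁ * a₂ + a₀ * b₁ * a₂ + a₀ * a₁ * b₂) ∨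
    0 < (a₀ * b₁ * b₂ + b₀ * a₁ * b₂ + b₀ * b₁ * a₂) * (b₀ * b₁ * b₂) := by
  obtain ⟨e1, e3, -, -⟩ := tripleLin_products a₀ a₁ a₂ b₀ b₁ b₂
  obtain ⟨ha0, hb0⟩ := mul_ne_zero_iff.mp h0.ne'; obtain ⟨ha1, hb1⟩ := mul_ne_zero_iff.mp h1.ne'
  rw [e1, e3]
  by_contra hcon; push Not at hcon; obtain ⟨hA, hB⟩ := hcon
  -- X := p₀ a₁²a₂² + p₁ a₀²a₂² ≤ -p₂ a₀²a₁²,  U := p₀ b₁²b₂² + p₁ b₀²b₂² ≤ -p₂ b₀²b₁²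
  have hX : 0 < (a₀ * b₀) * (a₁ ^ 2 * a₂ ^ 2) + (a₁ * b₁) * (a₀ ^ 2 * a₂ ^ 2) := by positivity
  have hU : 0 < (a₀ * b₀) * (b₁ ^ 2 * b₂ ^ 2) + (a₁ * b₁) * (b₀ ^ 2 * b₂ ^ 2) := by positivity
  have hA' : (a₀ * b₀) * (a₁ ^ 2 * a₂ ^ 2) + (a₁ * b₁) * (a₀ ^ 2 * a₂ ^ 2) ≤ -((a₂ * b₂) * (a₀ ^ 2 * a₁ ^ 2)) := by linarith
  have hB' : (a₀ * b₀) * (b₁ ^ 2 * b₂ ^ 2) + (a₁ * b₁) * (b₀ ^ 2 * b₂ ^ 2) ≤ -((a₂ * b₂) * (b₀ ^ 2 * b₁ ^ 2)) := by linarith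
  have hprod := mul_le_mul hA' hB' hU.le (by linarith)
  -- both sides carry the factor a₂²b₂² > 0
  have key : ((a₀ * b₀) * (a₁ ^ 2 * a₂ ^ 2) + (a₁ * b₁) * (a₀ ^ 2 * a₂ ^ 2))
        * ((a₀ * b₀) * (b₁ ^ 2 * b₂ ^ 2) + (a₁ * b₁) * (b₀ ^ 2 * b₂ ^ 2))
      = (a₂ ^ 2 * b₂ ^ 2) * (((a₀ * b₀) * a₁ ^ 2 + (a₁ * b₁) * a₀ ^ 2) * ((a₀ * b₀) * b₁ ^ 2 + (a₁ * b₁) * b₀ ^ 2)) := by ring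
  have key' : -((a₂ * b₂) * (a₀ ^ 2 * a₁ ^ 2)) * -((a₂ * b₂) * (b₀ ^ 2 * b₁ ^ 2))
      = (a₂ ^ 2 * b₂ ^ 2) * ((a₀ * b₀) ^ 2 * (a₁ * b₁) ^ 2) := by ring
  rw [key, key'] at hprod
  have hpos : 0 < a₂ ^ 2 * b₂ ^ 2 := by positivity
  have hle := le_of_mul_le_mul_left hprod hpos
  nlinarith [mul_pos h0 h1, mul_pos (mul_pos h0 h1) (show 0 < a₁ ^ 2 * b₀ ^ 2 + a₀ ^ 2 * b₁ ^ 2 by positivity),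
    sq_nonneg (a₀ * b₀ * b₁ ^ 2), sq_nonneg (a₁ * b₁ * a₀ ^ 2)]

/-- **Majority lemma, negative.**  If rows `0` and `1` are negative then `c₀c₁ < 0` or `c₂c₃ < 0`. [folklore] -/
theorem tripleLin_majority_neg {a₀ a₁ a₂ b₀ b₁ b₂ : ℝ} (h0 : a₀ * b₀ < 0) (h1 : a₁ * b₁ < 0) (ha2 : a₂ ≠ 0) (hb2 : b₂ ≠ 0) :
    (a₀ * a₁ * a₂) * (b₀ * a₁ * a₂ + a₀ * b₁ * a₂ + a₀ * a₁ * b₂) < 0 ∨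
    (a₀ * b₁ * b₂ + b₀ * a₁ * b₂ + b₀ * b₁ * a₂) * (b₀ * b₁ * b₂) < 0 := by
  rcases tripleLin_majority_pos (a₀ := a₀) (a₁ := a₁) (a₂ := a₂) (b₀ := -b₀) (b₁ := -b₁) (b₂ := -b₂)
    (by linarith) (by linarith) ha2 (neg_ne_zero.mpr hb2) with h | h <;> [left; right] <;> linarith

/-- **Descartes is exact for a product of three real linear forms (parity form).**  If the adjacent products of
`c₀ = a₀a₁a₂, c₁, c₂, c₃ = b₀b₁b₂` (coefficients of `∏ₙ(aₙ + bₙs)`, all `aₙ, bₙ ≠ 0`) have signs `(−1)^{s₁}, (−1)^{s₂}, (−1)^{s₃}`, then the number of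
odd `sₖ` (= sign changes = positive roots) equals the number of rows with `aₙbₙ < 0`. [folklore] -/
theorem tripleLin_count {a₀ a₁ a₂ b₀ b₁ b₂ c₀ c₁ c₂ c₃ : ℝ} {s₁ s₂ s₃ : ℕ}
    (ha : a₀ * a₁ * a₂ ≠ 0) (hb : b₀ * b₁ * b₂ ≠ 0)
    (hc₀ : c₀ = a₀ * a₁ * a₂) (hc₁ : c₁ = b₀ * a₁ * a₂ + a₀ * b₁ * a₂ + a₀ * a₁ * b₂)
    (hc₂ : c₂ = a₀ * b₁ * b₂ + b₀ * a₁ * b₂ + b₀ * b₁ * a₂) (hc₃ : c₃ = b₀ * b₁ * b₂)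
    (h₁ : 0 < (-1 : ℝ) ^ s₁ * (c₀ * c₁)) (h₂ : 0 < (-1 : ℝ) ^ s₂ * (c₁ * c₂)) (h₃ : 0 < (-1 : ℝ) ^ s₃ * (c₂ * c₃)) :
    s₁ % 2 + s₂ % 2 + s₃ % 2
      = (if a₀ * b₀ < 0 then 1 else 0) + (if a₁ * b₁ < 0 then 1 else 0) + (if a₂ * b₂ < 0 then 1 else 0) := by
  subst hc₀ hc₁ hc₂ hc₃
  obtain ⟨⟨ha0, ha1⟩, ha2⟩ := mul_ne_zero_iff.mp ha |>.imp_left mul_ne_zero_iff.mp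
  obtain ⟨⟨hb0, hb1⟩, hb2⟩ := mul_ne_zero_iff.mp hb |>.imp_left mul_ne_zero_iff.mp
  -- parity ↔ sign dictionary
  have odd_of_neg : ∀ {s : ℕ} {x : ℝ}, 0 < (-1 : ℝ) ^ s * x → x < 0 → s % 2 = 1 := fun {s x} hx hneg => by
    rcases Nat.mod_two_eq_zero_or_one s with h | h
    · rw [(Nat.even_iff.mpr h).neg_one_pow] at hx; linarith
    · exact h
  have even_of_pos : ∀ {s : ℕ} {x : ℝ}, 0 < (-1 : ℝ) ^ s * x → 0 < x → s % 2 = 0 := fun {s x} hx hpos => by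
    rcases Nat.mod_two_eq_zero_or_one s with h | h
    · exact h
    · rw [(Nat.odd_iff.mpr h).neg_one_pow] at hx; linarith
  -- total parity: (-1)^(s₁+s₂+s₃) has the sign of c₀c₃ = p₀p₁p₂
  obtain ⟨-, -, -, e03⟩ := tripleLin_products a₀ a₁ a₂ b₀ b₁ b₂
  have hprod : 0 < (-1 : ℝ) ^ (s₁ + s₂ + s₃) * ((a₀ * b₀) * (a₁ * b₁) * (a₂ * b₂))
      * ((b₀ * a₁ * a₂ + a₀ * b₁ * a₂ + a₀ * a₁ * b₂) ^ 2 * (a₀ * b₁ * b₂ + b₀ * a₁ * b₂ + b₀ * b₁ * a₂) ^ 2) := by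
    have := mul_pos (mul_pos h₁ h₂) h₃
    rw [← e03]
    calc (0 : ℝ) < _ := this
      _ = _ := by rw [pow_add, pow_add]; ring
  have hc1 : b₀ * a₁ * a₂ + a₀ * b₁ * a₂ + a₀ * a₁ * b₂ ≠ 0 := by
    rintro h; rw [h] at h₁; simp at h₁
  have hc2 : a₀ * b₁ * b₂ + b₀ * a₁ * b₂ + b₀ * b₁ * a₂ ≠ 0 := by
    rintro h; rw [h] at h₃; simp at h₃
  have hsq : 0 < (b₀ * a₁ * a₂ + a₀ * b₁ * a₂ + a₀ * a₁ * b₂) ^ 2 * (a₀ * b₁ * b₂ + b₀ * a₁ * b₂ + b₀ * b₁ * a₂) ^ 2 := by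
    positivity
  have htot : 0 < (-1 : ℝ) ^ (s₁ + s₂ + s₃) * ((a₀ * b₀) * (a₁ * b₁) * (a₂ * b₂)) :=
    (pos_iff_pos_of_mul_pos hprod).mpr hsq
  rcases lt_or_gt_of_ne (mul_ne_zero ha0 hb0) with n0 | p0 <;>
  rcases lt_or_gt_of_ne (mul_ne_zero ha1 hb1) with n1 | p1 <;>
  rcases lt_or_gt_of_ne (mul_ne_zero ha2 hb2) with n2 | p2
  · -- (−,−,−)
    obtain ⟨q1, q2, q3⟩ := tripleLin_all_neg n0 n1 n2
    rw [if_pos n0, if_pos n1, if_pos n2, odd_of_neg h₁ q1, odd_of_neg h₂ q2, odd_of_neg h₃ q3]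
  · -- (−,−,+): rows 0,1 negative, total parity even
    have hpar := even_of_pos htot (mul_pos (mul_pos_of_neg_of_neg n0 n1) p2)
    rw [if_pos n0, if_pos n1, if_neg (not_lt.mpr p2.le)]
    rcases tripleLin_majority_neg n0 n1 ha2 hb2 with q | q
    · have := odd_of_neg h₁ q; omega
    · have := odd_of_neg h₃ q; omega
  · -- (−,+,−): rows 0,2 negative
    have hpar := even_of_pos htot (mul_pos_of_neg_of_neg (mul_neg_of_neg_of_pos n0 p1) n2)
    rw [if_pos n0, if_neg (not_lt.mpr p1.le), if_pos n2]
    rcases tripleLin_majority_neg (a₀ := a₀) (a₁ := a₂) (a₂ := a₁) (b₀ := b₀) (b₁ := b₂) (b₂ := b₁) n0 n2 ha1 hb1 with q | q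
    · have := odd_of_neg h₁ (show (a₀ * a₁ * a₂) * (b₀ * a₁ * a₂ + a₀ * b₁ * a₂ + a₀ * a₁ * b₂) < 0 by linarith [q]); omega
    · have := odd_of_neg h₃ (show (a₀ * b₁ * b₂ + b₀ * a₁ * b₂ + b₀ * b₁ * a₂) * (b₀ * b₁ * b₂) < 0 by linarith [q]); omega
  · -- (−,+,+): rows 1,2 positive
    have hpar := odd_of_neg htot (mul_neg_of_neg_of_pos (mul_neg_of_neg_of_pos n0 p1) p2)
    rw [if_pos n0, if_neg (not_lt.mpr p1.le), if_neg (not_lt.mpr p2.le)]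
    rcases tripleLin_majority_pos (a₀ := a₁) (a₁ := a₂) (a₂ := a₀) (b₀ := b₁) (b₁ := b₂) (b₂ := b₀) p1 p2 ha0 hb0 with q | q
    · have := even_of_pos h₁ (show 0 < (a₀ * a₁ * a₂) * (b₀ * a₁ * a₂ + a₀ * b₁ * a₂ + a₀ * a₁ * b₂) by linarith [q]); omega
    · have := even_of_pos h₃ (show 0 < (a₀ * b₁ * b₂ + b₀ * a₁ * b₂ + b₀ * b₁ * a₂) * (b₀ * b₁ * b₂) by linarith [q]); omega
  · -- (+,−,−): rows 1,2 negative
    have hpar := even_of_pos htot (mul_pos_of_neg_of_neg (mul_neg_of_pos_of_neg p0 n1) n2)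
    rw [if_neg (not_lt.mpr p0.le), if_pos n1, if_pos n2]
    rcases tripleLin_majority_neg (a₀ := a₁) (a₁ := a₂) (a₂ := a₀) (b₀ := b₁) (b₁ := b₂) (b₂ := b₀) n1 n2 ha0 hb0 with q | q
    · have := odd_of_neg h₁ (show (a₀ * a₁ * a₂) * (b₀ * a₁ * a₂ + a₀ * b₁ * a₂ + a₀ * a₁ * b₂) < 0 by linarith [q]); omega
    · have := odd_of_neg h₃ (show (a₀ * b₁ * b₂ + b₀ * a₁ * b₂ + b₀ * b₁ * a₂) * (b₀ * b₁ * b₂) < 0 by linarith [q]); omega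
  · -- (+,−,+): rows 0,2 positive
    have hpar := odd_of_neg htot (mul_neg_of_neg_of_pos (mul_neg_of_pos_of_neg p0 n1) p2)
    rw [if_neg (not_lt.mpr p0.le), if_pos n1, if_neg (not_lt.mpr p2.le)]
    rcases tripleLin_majority_pos (a₀ := a₀) (a₁ := a₂) (a₂ := a₁) (b₀ := b₀) (b₁ := b₂) (b₂ := b₁) p0 p2 ha1 hb1 with q | q
    · have := even_of_pos h₁ (show 0 < (a₀ * a₁ * a₂) * (b₀ * a₁ * a₂ + a₀ * b₁ * a₂ + a₀ * a₁ * b₂) by linarith [q]); omega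
    · have := even_of_pos h₃ (show 0 < (a₀ * b₁ * b₂ + b₀ * a₁ * b₂ + b₀ * b₁ * a₂) * (b₀ * b₁ * b₂) by linarith [q]); omega
  · -- (+,+,−): rows 0,1 positive
    have hpar := odd_of_neg htot (mul_neg_of_pos_of_neg (mul_pos p0 p1) n2)
    rw [if_neg (not_lt.mpr p0.le), if_neg (not_lt.mpr p1.le), if_pos n2]
    rcases tripleLin_majority_pos p0 p1 ha2 hb2 with q | q
    · have := even_of_pos h₁ q; omega
    · have := even_of_pos h₃ q; omega
  · -- (+,+,+)
    obtain ⟨q1, q2, q3⟩ := tripleLin_all_pos p0 p1 p2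
    rw [if_neg (not_lt.mpr p0.le), if_neg (not_lt.mpr p1.le), if_neg (not_lt.mpr p2.le),
      even_of_pos h₁ q1, even_of_pos h₂ q2, even_of_pos h₃ q3]

/-- **Hamming bookkeeping for one row**: for non-zero reals `u, v, w` the three indicators `[uv<0], [uw<0], [vw<0]` have sum `≤ 2` and
satisfy the triangle inequality. [folklore] -/
theorem hamming_row (u v w : ℝ) (h : u * v * w ≠ 0) :
    (if u * v < 0 then 1 else 0) + (if u * w < 0 then 1 else 0) + (if v * w < 0 then 1 else 0) ≤ 2 ∧
    (if u * v < 0 then 1 else 0) ≤ (if u * w < 0 then 1 else 0) + (if v * w < 0 then 1 else 0) ∧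
    (if u * w < 0 then 1 else 0) ≤ (if u * v < 0 then 1 else 0) + (if v * w < 0 then 1 else 0) ∧
    (if v * w < 0 then 1 else 0) ≤ (if u * v < 0 then 1 else 0) + (if u * w < 0 then 1 else 0) := by
  have hu0 : u ≠ 0 := fun h0 => h (by rw [h0]; ring)
  have hv0 : v ≠ 0 := fun h0 => h (by rw [h0]; ring)
  have hw0 : w ≠ 0 := fun h0 => h (by rw [h0]; ring)
  rcases lt_or_gt_of_ne hu0 with hu | hu <;> rcases lt_or_gt_of_ne hv0 with hv | hv <;> rcases lt_or_gt_of_ne hw0 with hw | hw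
  · rw [if_neg (not_lt.mpr (mul_pos_of_neg_of_neg hu hv).le), if_neg (not_lt.mpr (mul_pos_of_neg_of_neg hu hw).le), if_neg (not_lt.mpr (mul_pos_of_neg_of_neg hv hw).le)]; omega
  · rw [if_neg (not_lt.mpr (mul_pos_of_neg_of_neg hu hv).le), if_pos (mul_neg_of_neg_of_pos hu hw), if_pos (mul_neg_of_neg_of_pos hv hw)]; omega
  · rw [if_pos (mul_neg_of_neg_of_pos hu hv), if_neg (not_lt.mpr (mul_pos_of_neg_of_neg hu hw).le), if_pos (mul_neg_of_pos_of_neg hv hw)]; omega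
  · rw [if_pos (mul_neg_of_neg_of_pos hu hv), if_pos (mul_neg_of_neg_of_pos hu hw), if_neg (not_lt.mpr (mul_pos hv hw).le)]; omega
  · rw [if_pos (mul_neg_of_pos_of_neg hu hv), if_pos (mul_neg_of_pos_of_neg hu hw), if_neg (not_lt.mpr (mul_pos_of_neg_of_neg hv hw).le)]; omega
  · rw [if_pos (mul_neg_of_pos_of_neg hu hv), if_neg (not_lt.mpr (mul_pos hu hw).le), if_pos (mul_neg_of_neg_of_pos hv hw)]; omega
  · rw [if_neg (not_lt.mpr (mul_pos hu hv).le), if_pos (mul_neg_of_pos_of_neg hu hw), if_pos (mul_neg_of_pos_of_neg hv hw)]; omega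
  · rw [if_neg (not_lt.mpr (mul_pos hu hv).le), if_neg (not_lt.mpr (mul_pos hu hw).le), if_neg (not_lt.mpr (mul_pos hv hw).le)]; omega

/-! ## 2. Diagonal letters: the face block is a product of three row nomials -/

/-- **Determinant of a diagonal letter**: the product of its diagonal entries. [folklore] -/
theorem det_diagLetter (S : Matrix (Fin 3) (Fin 3) ℝ) (h : ∀ a b : Fin 3, a ≠ b → S a b = 0) :
    S.det = S 0 0 * S 1 1 * S 2 2 := by
  rw [Matrix.det_fin_three, h 0 1 (by decide), h 0 2 (by decide), h 1 0 (by decide), h 1 2 (by decide),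
    h 2 0 (by decide), h 2 1 (by decide)]
  ring

/-- **Polarised determinant of two diagonal letters**: `tr(adj S · T) = Σₙ Tₙₙ ∏_{n'≠n} S_{n'n'}`. [folklore] -/
theorem trace_adjugate_diagLetters (S T : Matrix (Fin 3) (Fin 3) ℝ) (hS : ∀ a b : Fin 3, a ≠ b → S a b = 0)
    (hT : ∀ a b : Fin 3, a ≠ b → T a b = 0) :
    (S.adjugate * T).trace = T 0 0 * S 1 1 * S 2 2 + S 0 0 * T 1 1 * S 2 2 + S 0 0 * S 1 1 * T 2 2 := by
  simp only [Matrix.trace_fin_three, Matrix.mul_apply, Fin.sum_univ_three, Matrix.adjugate_fin_three, Matrix.of_apply,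
    Matrix.cons_val', Matrix.cons_val_zero, Matrix.cons_val_one, Matrix.cons_val_two, Matrix.empty_val',
    Matrix.cons_val_fin_one, Matrix.head_cons, Matrix.tail_cons, Matrix.head_fin_const,
    hS 0 1 (by decide), hS 0 2 (by decide), hS 1 0 (by decide), hS 1 2 (by decide), hS 2 0 (by decide), hS 2 1 (by decide),
    hT 0 1 (by decide), hT 0 2 (by decide), hT 1 0 (by decide), hT 1 2 (by decide), hT 2 0 (by decide), hT 2 1 (by decide)]
  ring

/-! ## 3. A nineteen with two diagonal letters: the edge count is read off the support -/

/-- **Edge count for a nineteen with diagonal letters `S_i, S_j`.**  With `ρ` the rank function of the triple-sum table of `d` and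
`s₁ = ρ(3dᵢ)+ρ(2dᵢ+dⱼ)`, `s₂ = ρ(2dᵢ+dⱼ)+ρ(2dⱼ+dᵢ)`, `s₃ = ρ(2dⱼ+dᵢ)+ρ(3dⱼ)`, the number of odd `sₖ` (the sign changes on the edge) equals the
number of rows `n` with `(S_i)ₙₙ (S_j)ₙₙ < 0`. [folklore] -/
theorem diag_edge_count (d : Fin 4 → ℕ) (S : Fin 4 → Matrix (Fin 3) (Fin 3) ℝ) {i j : Fin 4} (hij : i ≠ j)
    (hi : ∀ a b : Fin 3, a ≠ b → S i a b = 0) (hj : ∀ a b : Fin 3, a ≠ b → S j a b = 0)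
    (h19 : 19 ≤ ((Matrix.det (∑ l, ((X : ℝ[X]) ^ d l) • (S l).map C)).roots.toFinset.filter (fun t => 0 < t)).card)
    (ρ : ℕ → ℕ) (hρ : ∀ e, ρ e = (((Finset.univ : Finset (Fin 4 × Fin 4 × Fin 4)).image
      (fun p => d p.1 + d p.2.1 + d p.2.2)).filter (· < e)).card) :
    (ρ (3 * d i) + ρ (2 * d i + d j)) % 2 + (ρ (2 * d i + d j) + ρ (2 * d j + d i)) % 2 + (ρ (2 * d j + d i) + ρ (3 * d j)) % 2
      = (if S i 0 0 * S j 0 0 < 0 then 1 else 0) + (if S i 1 1 * S j 1 1 < 0 then 1 else 0)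
        + (if S i 2 2 * S j 2 2 < 0 then 1 else 0) := by
  classical
  set P : ℝ[X] := (∑ l, (X : ℝ[X]) ^ d l • (S l).map C).det with hPdef
  have hP0 : P ≠ 0 := fun h0 => by
    rw [h0, Polynomial.roots_zero, Multiset.toFinset_zero, Finset.filter_empty, Finset.card_empty] at h19; omega
  set T : Finset ℕ := (Finset.univ : Finset (Fin 4 × Fin 4 × Fin 4)).image (fun p => d p.1 + d p.2.1 + d p.2.2) with hTdef
  have hT20 : T.card ≤ 20 := card_tripleSums_le_of_collapse d id (fun _ => rfl) (by decide)
  have hsum3 : (Finset.univ : Finset (Fin 3 → Fin 4)).image (fun g => ∑ t, d (g t)) = T := sumset_three_eq_tripleSums d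
  have hZ : ((Finset.univ : Finset (Fin 3 → Fin 4)).image (fun g => ∑ t, d (g t))).card
      ≤ (P.roots.toFinset.filter (fun t => 0 < t)).card + 1 := by rw [hsum3]; omega
  have hsupp : P.support = T := by rw [← hsum3]; exact support_det_pencil_eq_sumset_of_sharp d S hP0 hZ
  have hZ' : P.support.card ≤ (P.roots.toFinset.filter (fun t => 0 < t)).card + 1 := by rw [hsupp]; omega
  have memT : ∀ a b c : Fin 4, d a + d b + d c ∈ P.support := fun a b c => by
    rw [hsupp, hTdef]; exact Finset.mem_image.mpr ⟨(a, b, c), Finset.mem_univ _, rfl⟩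
  have hrank : ∀ e, (P.support.filter (· < e)).card = ρ e := fun e => by rw [hρ, hsupp]
  have hdi := det_letter_ne_zero_of_nineteen d S h19 i; have hdj := det_letter_ne_zero_of_nineteen d S h19 j
  rw [det_diagLetter _ hi] at hdi; rw [det_diagLetter _ hj] at hdj
  have hc0 : P.coeff (3 * d i) = S i 0 0 * S i 1 1 * S i 2 2 := by
    rw [hPdef, coeff_det_pencil_three_mul d S i (cube_unique_of_nineteen d S h19 i)]; exact det_diagLetter _ hi
  have hc3 : P.coeff (3 * d j) = S j 0 0 * S j 1 1 * S j 2 2 := by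
    rw [hPdef, coeff_det_pencil_three_mul d S j (cube_unique_of_nineteen d S h19 j)]; exact det_diagLetter _ hj
  have hc1 : P.coeff (2 * d i + d j)
      = S j 0 0 * S i 1 1 * S i 2 2 + S i 0 0 * S j 1 1 * S i 2 2 + S i 0 0 * S i 1 1 * S j 2 2 := by
    rw [hPdef, coeff_det_pencil_three_square d S hij (square_unique_of_nineteen d S h19 hij)]
    exact trace_adjugate_diagLetters _ _ hi hj
  have hc2 : P.coeff (2 * d j + d i)
      = S i 0 0 * S j 1 1 * S j 2 2 + S j 0 0 * S i 1 1 * S j 2 2 + S j 0 0 * S j 1 1 * S i 2 2 := by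
    rw [hPdef, coeff_det_pencil_three_square d S hij.symm (square_unique_of_nineteen d S h19 hij.symm),
      trace_adjugate_diagLetters _ _ hj hi]
  obtain ⟨m0, m3⟩ : 3 * d i ∈ P.support ∧ 3 * d j ∈ P.support :=
    ⟨by rw [show 3 * d i = d i + d i + d i by ring]; exact memT i i i, by rw [show 3 * d j = d j + d j + d j by ring]; exact memT j j j⟩
  have m1 : 2 * d i + d j ∈ P.support := by rw [show 2 * d i + d j = d i + d i + d j by ring]; exact memT i i j
  have m2 : 2 * d j + d i ∈ P.support := by rw [show 2 * d j + d i = d j + d j + d i by ring]; exact memT j j i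
  have r1 := pow_rank_mul_coeff_mul_coeff_pos_of_sharp P hZ' m0 m1; have r2 := pow_rank_mul_coeff_mul_coeff_pos_of_sharp P hZ' m1 m2
  have r3 := pow_rank_mul_coeff_mul_coeff_pos_of_sharp P hZ' m2 m3
  rw [hrank, hrank] at r1 r2 r3
  exact tripleLin_count hdi hdj hc0 hc1 hc2 hc3 r1 r2 r3

/-! ## 4. The Hamming law -/

/-- **DIAGONAL-TRIPLE HAMMING LAW (all supports).**  Let a real `3 × 3` four-letter lacunary pencil have DIAGONAL letters `S_i, S_j, S_k` (the three
indices other than `m`; `S_m` arbitrary).  Let `ρ e` be the rank of `e` in the triple-sum table of `d` and, for an edge `{a,b}`, `V_ab` the number of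
odd sums among `ρ(3d_a)+ρ(2d_a+d_b)`, `ρ(2d_a+d_b)+ρ(2d_b+d_a)`, `ρ(2d_b+d_a)+ρ(3d_b)`.  If `V_ij + V_ik + V_jk = 8` or one of the three exceeds the
sum of the other two, the determinant has at most `18` distinct positive roots. [folklore] -/
theorem card_posRoots_diagTriple_le_18 (d : Fin 4 → ℕ) (S : Fin 4 → Matrix (Fin 3) (Fin 3) ℝ) (m i j k : Fin 4)
    (him : i ≠ m) (hjm : j ≠ m) (hkm : k ≠ m) (hij : i ≠ j) (hik : i ≠ k) (hjk : j ≠ k)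
    (hdiag : ∀ l, l ≠ m → ∀ a b : Fin 3, a ≠ b → S l a b = 0)
    (ρ : ℕ → ℕ) (hρ : ∀ e, ρ e = (((Finset.univ : Finset (Fin 4 × Fin 4 × Fin 4)).image
      (fun p => d p.1 + d p.2.1 + d p.2.2)).filter (· < e)).card)
    (htest :
      let Vij := (ρ (3 * d i) + ρ (2 * d i + d j)) % 2 + (ρ (2 * d i + d j) + ρ (2 * d j + d i)) % 2
        + (ρ (2 * d j + d i) + ρ (3 * d j)) % 2
      let Vik := (ρ (3 * d i) + ρ (2 * d i + d k)) % 2 + (ρ (2 * d i + d k) + ρ (2 * d k + d i)) % 2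
        + (ρ (2 * d k + d i) + ρ (3 * d k)) % 2
      let Vjk := (ρ (3 * d j) + ρ (2 * d j + d k)) % 2 + (ρ (2 * d j + d k) + ρ (2 * d k + d j)) % 2
        + (ρ (2 * d k + d j) + ρ (3 * d k)) % 2
      Vij + Vik + Vjk = 8 ∨ Vik + Vjk < Vij ∨ Vij + Vjk < Vik ∨ Vij + Vik < Vjk) :
    ((Matrix.det (∑ l, ((X : ℝ[X]) ^ d l) • (S l).map C)).roots.toFinset.filter (fun t => 0 < t)).card ≤ 18 := by
  by_contra hlt; push Not at hlt
  have h19 : 19 ≤ ((Matrix.det (∑ l, ((X : ℝ[X]) ^ d l) • (S l).map C)).roots.toFinset.filter (fun t => 0 < t)).card := by omega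
  have eij := diag_edge_count d S hij (hdiag i him) (hdiag j hjm) h19 ρ hρ
  have eik := diag_edge_count d S hik (hdiag i him) (hdiag k hkm) h19 ρ hρ
  have ejk := diag_edge_count d S hjk (hdiag j hjm) (hdiag k hkm) h19 ρ hρ
  have hdi := det_letter_ne_zero_of_nineteen d S h19 i; have hdj := det_letter_ne_zero_of_nineteen d S h19 j
  have hdk := det_letter_ne_zero_of_nineteen d S h19 k
  rw [det_diagLetter _ (hdiag i him)] at hdi; rw [det_diagLetter _ (hdiag j hjm)] at hdj; rw [det_diagLetter _ (hdiag k hkm)] at hdk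
  obtain ⟨⟨hi0, hi1⟩, hi2⟩ := mul_ne_zero_iff.mp hdi |>.imp_left mul_ne_zero_iff.mp
  obtain ⟨⟨hj0, hj1⟩, hj2⟩ := mul_ne_zero_iff.mp hdj |>.imp_left mul_ne_zero_iff.mp
  obtain ⟨⟨hk0, hk1⟩, hk2⟩ := mul_ne_zero_iff.mp hdk |>.imp_left mul_ne_zero_iff.mp
  obtain ⟨a0, b0, c0, d0⟩ := hamming_row _ _ _ (mul_ne_zero (mul_ne_zero hi0 hj0) hk0)
  obtain ⟨a1, b1, c1, d1⟩ := hamming_row _ _ _ (mul_ne_zero (mul_ne_zero hi1 hj1) hk1)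
  obtain ⟨a2, b2, c2, d2⟩ := hamming_row _ _ _ (mul_ne_zero (mul_ne_zero hi2 hj2) hk2)
  dsimp only at htest
  rw [eij, eik, ejk] at htest; clear eij eik ejk hρ hdi hdj hdk h19 hlt
  set x0 : ℕ := (if S i 0 0 * S j 0 0 < 0 then 1 else 0) with hx0
  set x1 : ℕ := (if S i 1 1 * S j 1 1 < 0 then 1 else 0) with hx1
  set x2 : ℕ := (if S i 2 2 * S j 2 2 < 0 then 1 else 0) with hx2
  set y0 : ℕ := (if S i 0 0 * S k 0 0 < 0 then 1 else 0) with hy0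
  set y1 : ℕ := (if S i 1 1 * S k 1 1 < 0 then 1 else 0) with hy1
  set y2 : ℕ := (if S i 2 2 * S k 2 2 < 0 then 1 else 0) with hy2
  set z0 : ℕ := (if S j 0 0 * S k 0 0 < 0 then 1 else 0) with hz0
  set z1 : ℕ := (if S j 1 1 * S k 1 1 < 0 then 1 else 0) with hz1
  set z2 : ℕ := (if S j 2 2 * S k 2 2 < 0 then 1 else 0) with hz2
  clear_value x0 x1 x2 y0 y1 y2 z0 z1 z2; omega

/-- **Congruence form.**  The same conclusion when `S_l = Pᵀ D_l P` (`l ≠ m`) for ONE invertible real `P` and diagonal `D_l` — three letters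
SIMULTANEOUSLY DIAGONALISABLE by a congruence — the count being a congruence invariant (`…SpanRankDiagonal.posRootCount_congr`). [folklore] -/
theorem card_posRoots_diagTriple_congr_le_18 (d : Fin 4 → ℕ) (D : Fin 4 → Matrix (Fin 3) (Fin 3) ℝ) (P : Matrix (Fin 3) (Fin 3) ℝ)
    (hP : P.det ≠ 0) (m i j k : Fin 4)
    (him : i ≠ m) (hjm : j ≠ m) (hkm : k ≠ m) (hij : i ≠ j) (hik : i ≠ k) (hjk : j ≠ k)
    (hdiag : ∀ l, l ≠ m → ∀ a b : Fin 3, a ≠ b → D l a b = 0)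
    (ρ : ℕ → ℕ) (hρ : ∀ e, ρ e = (((Finset.univ : Finset (Fin 4 × Fin 4 × Fin 4)).image
      (fun p => d p.1 + d p.2.1 + d p.2.2)).filter (· < e)).card)
    (htest :
      let Vij := (ρ (3 * d i) + ρ (2 * d i + d j)) % 2 + (ρ (2 * d i + d j) + ρ (2 * d j + d i)) % 2
        + (ρ (2 * d j + d i) + ρ (3 * d j)) % 2
      let Vik := (ρ (3 * d i) + ρ (2 * d i + d k)) % 2 + (ρ (2 * d i + d k) + ρ (2 * d k + d i)) % 2
        + (ρ (2 * d k + d i) + ρ (3 * d k)) % 2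
      let Vjk := (ρ (3 * d j) + ρ (2 * d j + d k)) % 2 + (ρ (2 * d j + d k) + ρ (2 * d k + d j)) % 2
        + (ρ (2 * d k + d j) + ρ (3 * d k)) % 2
      Vij + Vik + Vjk = 8 ∨ Vik + Vjk < Vij ∨ Vij + Vjk < Vik ∨ Vij + Vik < Vjk) :
    ((Matrix.det (∑ l, ((X : ℝ[X]) ^ d l) • (Pᵀ * D l * P).map C)).roots.toFinset.filter (fun t => 0 < t)).card ≤ 18 := by
  have hcongr := SpanRank.posRootCount_congr d D Pᵀ (by rwa [Matrix.det_transpose])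
  simp only [Matrix.transpose_transpose] at hcongr
  change posRootCount d (fun l => Pᵀ * D l * P) ≤ 18; rw [show posRootCount d (fun l => Pᵀ * D l * P) = posRootCount d D from hcongr]
  exact card_posRoots_diagTriple_le_18 d D m i j k him hjm hkm hij hik hjk hdiag ρ hρ htest

/-! ## 5. Instances on census supports (the Hamming test by `decide`) -/

/-- **`(0,1,7,11)`, free letter at `X^0`** (`m = 0`; face `{1,2,3}`, `V = (3,2,3)`, sum `8`): three diagonal letters on `X^1, X^7, X^11` plus any
letter on `X^0` give at most `18` distinct positive roots. [folklore] -/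
theorem card_posRoots_diagTriple_le_18_on_0_1_7_11 (S : Fin 4 → Matrix (Fin 3) (Fin 3) ℝ)
    (hdiag : ∀ l, l ≠ 0 → ∀ a b : Fin 3, a ≠ b → S l a b = 0) :
    ((Matrix.det (∑ l, ((X : ℝ[X]) ^ (![0, 1, 7, 11] : Fin 4 → ℕ) l) • (S l).map C)).roots.toFinset.filter (fun t => 0 < t)).card ≤ 18 := by
  have hT : ((Finset.univ : Finset (Fin 4 × Fin 4 × Fin 4)).image
      (fun p => (![0, 1, 7, 11] : Fin 4 → ℕ) p.1 + (![0, 1, 7, 11] : Fin 4 → ℕ) p.2.1 + (![0, 1, 7, 11] : Fin 4 → ℕ) p.2.2))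
        = ({0, 1, 2, 3, 7, 8, 9, 11, 12, 13, 14, 15, 18, 19, 21, 22, 23, 25, 29, 33} : Finset ℕ) := by decide
  refine card_posRoots_diagTriple_le_18 _ S 0 1 2 3 (by decide) (by decide) (by decide) (by decide) (by decide) (by decide) hdiag
    (fun e => ((({0, 1, 2, 3, 7, 8, 9, 11, 12, 13, 14, 15, 18, 19, 21, 22, 23, 25, 29, 33} : Finset ℕ)).filter (· < e)).card) (fun e => by rw [hT]) ?_
  decide

/-- **`(0,4,9,16)`, free letter at the TOP `X^16`** (`m = 3`; `V = (2,3,3)`, sum `8`; the support of a census `W`-seventeen): at most `18`. [folklore] -/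
theorem card_posRoots_diagTriple_le_18_on_0_4_9_16_top (S : Fin 4 → Matrix (Fin 3) (Fin 3) ℝ)
    (hdiag : ∀ l, l ≠ 3 → ∀ a b : Fin 3, a ≠ b → S l a b = 0) :
    ((Matrix.det (∑ l, ((X : ℝ[X]) ^ (![0, 4, 9, 16] : Fin 4 → ℕ) l) • (S l).map C)).roots.toFinset.filter (fun t => 0 < t)).card ≤ 18 := by
  have hT : ((Finset.univ : Finset (Fin 4 × Fin 4 × Fin 4)).image
      (fun p => (![0, 4, 9, 16] : Fin 4 → ℕ) p.1 + (![0, 4, 9, 16] : Fin 4 → ℕ) p.2.1 + (![0, 4, 9, 16] : Fin 4 → ℕ) p.2.2))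
        = ({0, 4, 8, 9, 12, 13, 16, 17, 18, 20, 22, 24, 25, 27, 29, 32, 34, 36, 41, 48} : Finset ℕ) := by decide
  refine card_posRoots_diagTriple_le_18 _ S 3 0 1 2 (by decide) (by decide) (by decide) (by decide) (by decide) (by decide) hdiag
    (fun e => ((({0, 4, 8, 9, 12, 13, 16, 17, 18, 20, 22, 24, 25, 27, 29, 32, 34, 36, 41, 48} : Finset ℕ)).filter (· < e)).card) (fun e => by rw [hT]) ?_
  decide

/-- **`(0,2,9,12)`, free letter at `X^0`** (`m = 0`; `V = (1,0,3)`: triangle inequality fails): at most `18`. [folklore] -/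
theorem card_posRoots_diagTriple_le_18_on_0_2_9_12 (S : Fin 4 → Matrix (Fin 3) (Fin 3) ℝ)
    (hdiag : ∀ l, l ≠ 0 → ∀ a b : Fin 3, a ≠ b → S l a b = 0) :
    ((Matrix.det (∑ l, ((X : ℝ[X]) ^ (![0, 2, 9, 12] : Fin 4 → ℕ) l) • (S l).map C)).roots.toFinset.filter (fun t => 0 < t)).card ≤ 18 := by
  have hT : ((Finset.univ : Finset (Fin 4 × Fin 4 × Fin 4)).image
      (fun p => (![0, 2, 9, 12] : Fin 4 → ℕ) p.1 + (![0, 2, 9, 12] : Fin 4 → ℕ) p.2.1 + (![0, 2, 9, 12] : Fin 4 → ℕ) p.2.2))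
        = ({0, 2, 4, 6, 9, 11, 12, 13, 14, 16, 18, 20, 21, 23, 24, 26, 27, 30, 33, 36} : Finset ℕ) := by decide
  refine card_posRoots_diagTriple_le_18 _ S 0 1 2 3 (by decide) (by decide) (by decide) (by decide) (by decide) (by decide) hdiag
    (fun e => ((({0, 2, 4, 6, 9, 11, 12, 13, 14, 16, 18, 20, 21, 23, 24, 26, 27, 30, 33, 36} : Finset ℕ)).filter (· < e)).card) (fun e => by rw [hT]) ?_
  decide

end Summit.ValiantsHypothesis.ValiantsHypothesis.Theorems.LacunarySymmetroidMatrixDescartes.Census
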